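import Summits.Ventures.CertifiedManyBodySolver.Theorems.R2cGcTangentConsumer
import Summits.Ventures.CertifiedManyBodySolver.HubbardAlg.MbsolverRungLeaves
import Literature.MathematicalPhysics.QuantumLattice.HubbardJordanWigner
import HarnessLib

/-!
# The GC (`μ = 8/5`) tangent-line consumer, part III: boxes of any shape, the LENGTH-MAJOR turnkey and its
SPIN-SIDE (Jordan–Wigner) socket — for the cruxes `RightFamilyBelowLine` (stmt-Ventures-19262) /
`LeftFamilyBelowLine` (stmt-Ventures-19263) of route `R2cOpenStripTangentLine` and the rung leaf `M3Upper_tp0_le_m18o25`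

HONEST FRAMING: first certified bounds; not a superconductivity verdict; every number certified or labelled float.
NO NUMBER IS CLAIMED HERE: every leaf-valued theorem is an implication from the data + sentence a producer's
certificate would assert (`proof.conditional` by design). Route-independent (imports no `Theses` file).

Parts I/II (`Theorems/R2cGcTangentConsumer.lean`, `…Leaf.lean`) type the `k`-th member of a grand-canonical all-`k`
family on the open box `a × (k·b)` = `Fin a ×ₗ Fin (k*b)`, whose Jordan–Wigner (Lex) order runs along the LENGTH
inside each of the `a` rows. The producers this consumer is for — `a = ∞` strip / column states with a `W`-site
column and an `nc`-column cell (uMPS / isometric tensor networks with a Bellman-type certificate, e.g. the cell format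
`bd-strip-cell-v1` of crew hubbard-upper: "JW column-major, sites `r = x·W + y`") — enumerate the strip
COLUMN-BY-COLUMN, i.e. their finite descendants live on `Fin (k·nc) ×ₗ Fin W` (Lex = column index outer, the `W`
sites of a column contiguous), and they are written on the SPIN side (`TensorIndex _ 4 → ℂ`, operators through
`JordanWigner.toSpin`). This file provides exactly that socket, so that a strip/column certificate consumer (the
2-D analogue of `Upper.UMPSCellEnergyBound`, not yet written) ends in ONE `exact`:

* `energyDensityTT'_le_of_gcFamily_right_anyBox` / `_left_anyBox` (part I, §3b) are used here through
  `gcConsumerRight_anyBox` / `gcConsumerLeft_anyBox` / `m3Upper_tp0_le_m18o25_of_gcFamilies_anyBox`: the route's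
  numbers `(t,t',U) = (1,0,8)`, `μ = 8/5`, `ρ = 7/8`, `c = -18/25` (`c - μρ = -53/25`) for families whose `k`-th
  member lives on ANY open box with `k·ab` sites;
* `m3Upper_tp0_le_m18o25_of_gcDefectFamily_lengthMajor` — ONE number-indefinite object on the length-major boxes
  `(k·b) × a` (Fock side) with `μ`-shifted energy `≤ (kE + (k-1)Δ)·S`, `(E + Δ)/(ab) ≤ -53/25`, and mean particle
  number within a `k`-free defect `q·S` of `(7/8)·abk·S` gives the leaf (both one-sided GC families at once);
* `m3Upper_tp0_le_m18o25_of_gcDefectFamily` — the same ONE-object turnkey in the width-major orientation of parts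
  I/II (`a × (k·b)`, rows contiguous);
* `m3Upper_tp0_le_m18o25_of_spin_gcDefectFamily_lengthMajor` / `_of_spin_gcDefectFamily` — the same sentences stated on the SPIN side
  (`φ_l : TensorIndex (Fin (k*b) ×ₗ Fin a) 4 → ℂ`, `toSpin (hubbardOpenBoxTT' (k*b) a 1 0 8)`, `toSpin totalNumber`),
  transported by the Jordan–Wigner isometry `JordanWigner.toSpinVec` exactly as in `Theorems.boxSpinConsumer_proof`.

Sources: Ruelle, *Statistical Mechanics* (1969) §3.3–3.4 [Ruelle1969]; Essler–Frahm–Göhmann–Klümper–Korepin, *The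
One-Dimensional Hubbard Model* (2005) §12.3.4 (Jordan–Wigner) [EsslerEtAl2005]; LeBlanc et al., PRX 5 (2015) 041041,
eq. (1) [LeBlancEtAl2015].
-/

noncomputable section

open Matrix Finset
open scoped ComplexOrder BigOperators

namespace Summit.Ventures.CertifiedManyBodySolver.Theorems

open Literature.MathematicalPhysics.QuantumLattice
open Literature.MathematicalPhysics.QuantumLattice.ThermodynamicLimit

/-! ### §1 The route's numbers on boxes of any shape -/

/-- **`GcConsumerRight` on boxes of any shape**: a RIGHT grand-canonical all-`k` family at `(1,0,8)` below `-53/25` per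
site for `H - (8/5)N̂`, mean-density endpoint `≥ 7/8`, whose `k`-th member lives on any open box with `k·ab` sites, forces
the leaf value for every supporting slope `s ≥ 8/5` at `7/8`. [cite: Ruelle1969, §3.4] -/
theorem gcConsumerRight_anyBox :
    (∃ a b : ℕ, ∃ E Δ M Γ : ℚ, 1 ≤ a ∧ 1 ≤ b ∧
      (E + Δ) / ((a : ℚ) * (b : ℚ)) ≤ -53 / 25 ∧
      (7 / 8 : ℚ) * ((a : ℚ) * (b : ℚ)) ≤ M + Γ ∧
      ∀ k : ℕ, 1 ≤ k → ∃ a' b' : ℕ, 1 ≤ a' ∧ 1 ≤ b' ∧ a' * b' = k * (a * b) ∧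
        ∃ m : ℕ, ∃ ψ : Fin m → Fock (Orb (Fin a' ×ₗ Fin b')),
        0 < ∑ l, (star (ψ l) ⬝ᵥ ψ l).re ∧
        ∑ l, (star (ψ l) ⬝ᵥ (hubbardOpenBoxTT' a' b' 1 0 8 *ᵥ ψ l)).re
            - (8 / 5 : ℝ) * ∑ l, (star (ψ l) ⬝ᵥ (totalNumber *ᵥ ψ l)).re
          ≤ (((k : ℚ) * E + ((k : ℚ) - 1) * Δ : ℚ) : ℝ) * ∑ l, (star (ψ l) ⬝ᵥ ψ l).re ∧
        (((k : ℚ) * M + ((k : ℚ) - 1) * Γ : ℚ) : ℝ) * ∑ l, (star (ψ l) ⬝ᵥ ψ l).re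
          ≤ ∑ l, (star (ψ l) ⬝ᵥ (totalNumber *ᵥ ψ l)).re) →
    ∀ s : ℝ, 8 / 5 ≤ s →
      (∀ x ∈ Set.Ico (0 : ℝ) 2,
        energyDensityTT' 1 0 8 (7 / 8) + s * (x - 7 / 8) ≤ energyDensityTT' 1 0 8 x) →
      energyDensityTT' 1 0 8 (7 / 8) ≤ -18 / 25 := by
  rintro ⟨a, b, E, Δ, M, Γ, ha, hb, hE, hM, hfam⟩ s hμs hs
  have hab : (0 : ℚ) < (a : ℚ) * (b : ℚ) := by exact_mod_cast Nat.mul_pos ha hb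
  rw [div_le_iff₀ hab] at hE
  have hE' : ((E + Δ : ℚ) : ℝ) ≤ ((-53 / 25 * ((a : ℚ) * (b : ℚ)) : ℚ) : ℝ) := by exact_mod_cast hE
  have hM' : (((7 / 8 : ℚ) * ((a : ℚ) * (b : ℚ)) : ℚ) : ℝ) ≤ ((M + Γ : ℚ) : ℝ) := by exact_mod_cast hM
  push_cast at hE' hM'
  refine energyDensityTT'_le_of_gcFamily_right_anyBox 1 0 (U := 8) (by norm_num) (8 / 5) (-18 / 25) hμs hs ha hb
    (E := (E : ℝ)) (Δ := (Δ : ℝ)) (M := (M : ℝ)) (Γ := (Γ : ℝ)) (by linarith) (by linarith) fun k hk => ?_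
  obtain ⟨a', b', ha', hb', hcount, m, ψ, hS, hH, hN⟩ := hfam k hk
  refine ⟨a', b', ha', hb', hcount, m, ψ, hS, ?_, ?_⟩
  · push_cast at hH; exact hH
  · push_cast at hN; exact hN

/-- **`GcConsumerLeft` on boxes of any shape**: the LEFT family (mean-density endpoint `≤ 7/8`, mean number bounded
above) forces the leaf value for every supporting slope `s ≤ 8/5`. [cite: Ruelle1969, §3.4] -/
theorem gcConsumerLeft_anyBox :
    (∃ a b : ℕ, ∃ E Δ M Γ : ℚ, 1 ≤ a ∧ 1 ≤ b ∧
      (E + Δ) / ((a : ℚ) * (b : ℚ)) ≤ -53 / 25 ∧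
      M + Γ ≤ (7 / 8 : ℚ) * ((a : ℚ) * (b : ℚ)) ∧
      ∀ k : ℕ, 1 ≤ k → ∃ a' b' : ℕ, 1 ≤ a' ∧ 1 ≤ b' ∧ a' * b' = k * (a * b) ∧
        ∃ m : ℕ, ∃ ψ : Fin m → Fock (Orb (Fin a' ×ₗ Fin b')),
        0 < ∑ l, (star (ψ l) ⬝ᵥ ψ l).re ∧
        ∑ l, (star (ψ l) ⬝ᵥ (hubbardOpenBoxTT' a' b' 1 0 8 *ᵥ ψ l)).re
            - (8 / 5 : ℝ) * ∑ l, (star (ψ l) ⬝ᵥ (totalNumber *ᵥ ψ l)).re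
          ≤ (((k : ℚ) * E + ((k : ℚ) - 1) * Δ : ℚ) : ℝ) * ∑ l, (star (ψ l) ⬝ᵥ ψ l).re ∧
        ∑ l, (star (ψ l) ⬝ᵥ (totalNumber *ᵥ ψ l)).re
          ≤ (((k : ℚ) * M + ((k : ℚ) - 1) * Γ : ℚ) : ℝ) * ∑ l, (star (ψ l) ⬝ᵥ ψ l).re) →
    ∀ s : ℝ, s ≤ 8 / 5 →
      (∀ x ∈ Set.Ico (0 : ℝ) 2,
        energyDensityTT' 1 0 8 (7 / 8) + s * (x - 7 / 8) ≤ energyDensityTT' 1 0 8 x) →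
      energyDensityTT' 1 0 8 (7 / 8) ≤ -18 / 25 := by
  rintro ⟨a, b, E, Δ, M, Γ, ha, hb, hE, hM, hfam⟩ s hsμ hs
  have hab : (0 : ℚ) < (a : ℚ) * (b : ℚ) := by exact_mod_cast Nat.mul_pos ha hb
  rw [div_le_iff₀ hab] at hE
  have hE' : ((E + Δ : ℚ) : ℝ) ≤ ((-53 / 25 * ((a : ℚ) * (b : ℚ)) : ℚ) : ℝ) := by exact_mod_cast hE
  have hM' : ((M + Γ : ℚ) : ℝ) ≤ (((7 / 8 : ℚ) * ((a : ℚ) * (b : ℚ)) : ℚ) : ℝ) := by exact_mod_cast hM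
  push_cast at hE' hM'
  refine energyDensityTT'_le_of_gcFamily_left_anyBox 1 0 (U := 8) (by norm_num) (8 / 5) (-18 / 25) hsμ hs ha hb
    (E := (E : ℝ)) (Δ := (Δ : ℝ)) (M := (M : ℝ)) (Γ := (Γ : ℝ)) (by linarith) (by linarith) fun k hk => ?_
  obtain ⟨a', b', ha', hb', hcount, m, ψ, hS, hH, hN⟩ := hfam k hk
  refine ⟨a', b', ha', hb', hcount, m, ψ, hS, ?_, ?_⟩
  · push_cast at hH; exact hH
  · push_cast at hN; exact hN

/-- **Both any-shape GC families ⇒ the rung leaf** `MbsolverRungLeaves.M3Upper_tp0_le_m18o25` (`e(1,0,8,7/8) ≤ -18/25`):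
a supporting line of the convex `e(1,0,8,·)` at `7/8` (`exists_supporting_line_energyDensityTT'`), split on its slope
`s ≶ 8/5`. [cite: Ruelle1969, §3.4] -/
theorem m3Upper_tp0_le_m18o25_of_gcFamilies_anyBox
    (hR : ∃ a b : ℕ, ∃ E Δ M Γ : ℚ, 1 ≤ a ∧ 1 ≤ b ∧
      (E + Δ) / ((a : ℚ) * (b : ℚ)) ≤ -53 / 25 ∧
      (7 / 8 : ℚ) * ((a : ℚ) * (b : ℚ)) ≤ M + Γ ∧
      ∀ k : ℕ, 1 ≤ k → ∃ a' b' : ℕ, 1 ≤ a' ∧ 1 ≤ b' ∧ a' * b' = k * (a * b) ∧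
        ∃ m : ℕ, ∃ ψ : Fin m → Fock (Orb (Fin a' ×ₗ Fin b')),
        0 < ∑ l, (star (ψ l) ⬝ᵥ ψ l).re ∧
        ∑ l, (star (ψ l) ⬝ᵥ (hubbardOpenBoxTT' a' b' 1 0 8 *ᵥ ψ l)).re
            - (8 / 5 : ℝ) * ∑ l, (star (ψ l) ⬝ᵥ (totalNumber *ᵥ ψ l)).re
          ≤ (((k : ℚ) * E + ((k : ℚ) - 1) * Δ : ℚ) : ℝ) * ∑ l, (star (ψ l) ⬝ᵥ ψ l).re ∧
        (((k : ℚ) * M + ((k : ℚ) - 1) * Γ : ℚ) : ℝ) * ∑ l, (star (ψ l) ⬝ᵥ ψ l).re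
          ≤ ∑ l, (star (ψ l) ⬝ᵥ (totalNumber *ᵥ ψ l)).re)
    (hL : ∃ a b : ℕ, ∃ E Δ M Γ : ℚ, 1 ≤ a ∧ 1 ≤ b ∧
      (E + Δ) / ((a : ℚ) * (b : ℚ)) ≤ -53 / 25 ∧
      M + Γ ≤ (7 / 8 : ℚ) * ((a : ℚ) * (b : ℚ)) ∧
      ∀ k : ℕ, 1 ≤ k → ∃ a' b' : ℕ, 1 ≤ a' ∧ 1 ≤ b' ∧ a' * b' = k * (a * b) ∧
        ∃ m : ℕ, ∃ ψ : Fin m → Fock (Orb (Fin a' ×ₗ Fin b')),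
        0 < ∑ l, (star (ψ l) ⬝ᵥ ψ l).re ∧
        ∑ l, (star (ψ l) ⬝ᵥ (hubbardOpenBoxTT' a' b' 1 0 8 *ᵥ ψ l)).re
            - (8 / 5 : ℝ) * ∑ l, (star (ψ l) ⬝ᵥ (totalNumber *ᵥ ψ l)).re
          ≤ (((k : ℚ) * E + ((k : ℚ) - 1) * Δ : ℚ) : ℝ) * ∑ l, (star (ψ l) ⬝ᵥ ψ l).re ∧
        ∑ l, (star (ψ l) ⬝ᵥ (totalNumber *ᵥ ψ l)).re
          ≤ (((k : ℚ) * M + ((k : ℚ) - 1) * Γ : ℚ) : ℝ) * ∑ l, (star (ψ l) ⬝ᵥ ψ l).re) :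
    Summit.Ventures.CertifiedManyBodySolver.MbsolverRungLeaves.M3Upper_tp0_le_m18o25 := by
  obtain ⟨s, hs⟩ := exists_supporting_line_energyDensityTT' 1 0 (U := 8) (by norm_num) (ρ := 7 / 8)
    (by norm_num) (by norm_num)
  have hleaf : energyDensityTT' 1 0 8 (7 / 8) ≤ -18 / 25 := by
    rcases le_total (8 / 5 : ℝ) s with h | h
    · exact gcConsumerRight_anyBox hR s h hs
    · exact gcConsumerLeft_anyBox hL s h hs
  refine ⟨-18 / 25, le_rfl, ?_⟩
  show energyDensityTT' 1 0 8 (7 / 8) ≤ (((-18 / 25 : ℚ)) : ℝ)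
  push_cast
  linarith [hleaf]

/-! ### §2 The length-major turnkey: ONE object on the boxes `(k·b) × a` -/

/-- **TURNKEY, length-major, ONE object.** Data: an open box `a × b` (`a` = the number of sites of a column, the
contiguous Jordan–Wigner block; `b` = the number of columns of a cell), rationals `E, Δ, q` with
`(E + Δ)/(ab) ≤ -53/25`, and for every `k ≥ 1` a finite vector family `ψ` on the open `(k·b) × a` cluster
(`Fin (k*b) ×ₗ Fin a`: Lex order = column index outer) at `(1,0,8)` with `S = Σ‖ψ_l‖² > 0`,
`Σ Re⟨ψ_l, H ψ_l⟩ - (8/5) Σ⟨ψ_l, N̂ ψ_l⟩ ≤ (kE + (k-1)Δ)·S` and `|Σ⟨ψ_l, N̂ ψ_l⟩ - (7/8)·abk·S| ≤ q·S` (two one-sided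
bounds). Then the rung leaf holds. (`m3Upper_tp0_le_m18o25_of_gcFamilies_anyBox` with `a' = k·b`, `b' = a`,
`M = 7/8·ab ∓ q`, `Γ = ±q`.) [cite: Ruelle1969, §3.4] -/
theorem m3Upper_tp0_le_m18o25_of_gcDefectFamily_lengthMajor (a b : ℕ) (E Δ q : ℚ) (ha : 1 ≤ a) (hb : 1 ≤ b)
    (hE : (E + Δ) / ((a : ℚ) * (b : ℚ)) ≤ -53 / 25)
    (h : ∀ k : ℕ, 1 ≤ k → ∃ m : ℕ, ∃ ψ : Fin m → Fock (Orb (Fin (k * b) ×ₗ Fin a)),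
        0 < ∑ l, (star (ψ l) ⬝ᵥ ψ l).re ∧
        ∑ l, (star (ψ l) ⬝ᵥ (hubbardOpenBoxTT' (k * b) a 1 0 8 *ᵥ ψ l)).re
            - (8 / 5 : ℝ) * ∑ l, (star (ψ l) ⬝ᵥ (totalNumber *ᵥ ψ l)).re
          ≤ (((k : ℚ) * E + ((k : ℚ) - 1) * Δ : ℚ) : ℝ) * ∑ l, (star (ψ l) ⬝ᵥ ψ l).re ∧
        (((7 / 8 : ℚ) * ((a : ℚ) * (b : ℚ)) * (k : ℚ) - q : ℚ) : ℝ) * ∑ l, (star (ψ l) ⬝ᵥ ψ l).re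
          ≤ ∑ l, (star (ψ l) ⬝ᵥ (totalNumber *ᵥ ψ l)).re ∧
        ∑ l, (star (ψ l) ⬝ᵥ (totalNumber *ᵥ ψ l)).re
          ≤ (((7 / 8 : ℚ) * ((a : ℚ) * (b : ℚ)) * (k : ℚ) + q : ℚ) : ℝ) * ∑ l, (star (ψ l) ⬝ᵥ ψ l).re) :
    Summit.Ventures.CertifiedManyBodySolver.MbsolverRungLeaves.M3Upper_tp0_le_m18o25 := by
  have hcount : ∀ k : ℕ, k * b * a = k * (a * b) := fun k => by ring
  refine m3Upper_tp0_le_m18o25_of_gcFamilies_anyBox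
    ⟨a, b, E, Δ, (7 / 8 : ℚ) * ((a : ℚ) * (b : ℚ)) - q, q, ha, hb, hE, by linarith, fun k hk => ?_⟩
    ⟨a, b, E, Δ, (7 / 8 : ℚ) * ((a : ℚ) * (b : ℚ)) + q, -q, ha, hb, hE, by linarith, fun k hk => ?_⟩
  · obtain ⟨m, ψ, hS, hH, hNlo, -⟩ := h k hk
    refine ⟨k * b, a, Nat.mul_pos hk hb, ha, hcount k, m, ψ, hS, hH, ?_⟩
    have : ((k : ℚ) * ((7 / 8 : ℚ) * ((a : ℚ) * (b : ℚ)) - q) + ((k : ℚ) - 1) * q : ℚ) =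
        ((7 / 8 : ℚ) * ((a : ℚ) * (b : ℚ)) * (k : ℚ) - q : ℚ) := by ring
    rw [this]; exact hNlo
  · obtain ⟨m, ψ, hS, hH, -, hNhi⟩ := h k hk
    refine ⟨k * b, a, Nat.mul_pos hk hb, ha, hcount k, m, ψ, hS, hH, ?_⟩
    have : ((k : ℚ) * ((7 / 8 : ℚ) * ((a : ℚ) * (b : ℚ)) + q) + ((k : ℚ) - 1) * (-q) : ℚ) =
        ((7 / 8 : ℚ) * ((a : ℚ) * (b : ℚ)) * (k : ℚ) + q : ℚ) := by ring
    rw [this]; exact hNhi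

/-- **TURNKEY, width-major, ONE object** (the orientation of parts I/II: boxes `a × (k·b)` = `Fin a ×ₗ Fin (k*b)`, each
of the `a` rows contiguous in the Jordan–Wigner order): the same sentence as
`m3Upper_tp0_le_m18o25_of_gcDefectFamily_lengthMajor` on `hubbardOpenBoxTT' a (k*b) 1 0 8` gives the rung leaf
(`a' = a`, `b' = k·b`). The two-object form is `m3Upper_tp0_le_m18o25_of_gcDefectFamilies` (part II).
[cite: Ruelle1969, §3.4] -/
theorem m3Upper_tp0_le_m18o25_of_gcDefectFamily (a b : ℕ) (E Δ q : ℚ) (ha : 1 ≤ a) (hb : 1 ≤ b)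
    (hE : (E + Δ) / ((a : ℚ) * (b : ℚ)) ≤ -53 / 25)
    (h : ∀ k : ℕ, 1 ≤ k → ∃ m : ℕ, ∃ ψ : Fin m → Fock (Orb (Fin a ×ₗ Fin (k * b))),
        0 < ∑ l, (star (ψ l) ⬝ᵥ ψ l).re ∧
        ∑ l, (star (ψ l) ⬝ᵥ (hubbardOpenBoxTT' a (k * b) 1 0 8 *ᵥ ψ l)).re
            - (8 / 5 : ℝ) * ∑ l, (star (ψ l) ⬝ᵥ (totalNumber *ᵥ ψ l)).re
          ≤ (((k : ℚ) * E + ((k : ℚ) - 1) * Δ : ℚ) : ℝ) * ∑ l, (star (ψ l) ⬝ᵥ ψ l).re ∧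
        (((7 / 8 : ℚ) * ((a : ℚ) * (b : ℚ)) * (k : ℚ) - q : ℚ) : ℝ) * ∑ l, (star (ψ l) ⬝ᵥ ψ l).re
          ≤ ∑ l, (star (ψ l) ⬝ᵥ (totalNumber *ᵥ ψ l)).re ∧
        ∑ l, (star (ψ l) ⬝ᵥ (totalNumber *ᵥ ψ l)).re
          ≤ (((7 / 8 : ℚ) * ((a : ℚ) * (b : ℚ)) * (k : ℚ) + q : ℚ) : ℝ) * ∑ l, (star (ψ l) ⬝ᵥ ψ l).re) :
    Summit.Ventures.CertifiedManyBodySolver.MbsolverRungLeaves.M3Upper_tp0_le_m18o25 := by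
  have hcount : ∀ k : ℕ, a * (k * b) = k * (a * b) := fun k => by ring
  refine m3Upper_tp0_le_m18o25_of_gcFamilies_anyBox
    ⟨a, b, E, Δ, (7 / 8 : ℚ) * ((a : ℚ) * (b : ℚ)) - q, q, ha, hb, hE, by linarith, fun k hk => ?_⟩
    ⟨a, b, E, Δ, (7 / 8 : ℚ) * ((a : ℚ) * (b : ℚ)) + q, -q, ha, hb, hE, by linarith, fun k hk => ?_⟩
  · obtain ⟨m, ψ, hS, hH, hNlo, -⟩ := h k hk
    refine ⟨a, k * b, ha, Nat.mul_pos hk hb, hcount k, m, ψ, hS, hH, ?_⟩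
    have : ((k : ℚ) * ((7 / 8 : ℚ) * ((a : ℚ) * (b : ℚ)) - q) + ((k : ℚ) - 1) * q : ℚ) =
        ((7 / 8 : ℚ) * ((a : ℚ) * (b : ℚ)) * (k : ℚ) - q : ℚ) := by ring
    rw [this]; exact hNlo
  · obtain ⟨m, ψ, hS, hH, -, hNhi⟩ := h k hk
    refine ⟨a, k * b, ha, Nat.mul_pos hk hb, hcount k, m, ψ, hS, hH, ?_⟩
    have : ((k : ℚ) * ((7 / 8 : ℚ) * ((a : ℚ) * (b : ℚ)) + q) + ((k : ℚ) - 1) * (-q) : ℚ) =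
        ((7 / 8 : ℚ) * ((a : ℚ) * (b : ℚ)) * (k : ℚ) + q : ℚ) := by ring
    rw [this]; exact hNhi


/-! ### §3 The spin-side (Jordan–Wigner) socket -/

/-- Spin-side matrix elements are Fock-side matrix elements of the Jordan–Wigner preimage:
`⟨φ, toSpin(A) φ⟩ = ⟨toSpinVec⁻¹ φ, A · toSpinVec⁻¹ φ⟩`. [cite: EsslerEtAl2005, §12.3.4 eq. (12.196)] -/
theorem star_dotProduct_toSpin_mulVec_eq {Λ : Type*} [LinearOrder Λ] [Fintype Λ]
    (A : Matrix (Finset (Orb Λ)) (Finset (Orb Λ)) ℂ) (φ : TensorIndex Λ 4 → ℂ) :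
    star φ ⬝ᵥ (JordanWigner.toSpin A *ᵥ φ) =
      star (JordanWigner.toSpinVec.symm φ) ⬝ᵥ (A *ᵥ JordanWigner.toSpinVec.symm φ) := by
  have hφ : JordanWigner.toSpinVec (JordanWigner.toSpinVec.symm φ) = φ :=
    LinearEquiv.apply_symm_apply _ φ
  have h := JordanWigner.expect_eq A (JordanWigner.toSpinVec.symm φ)
  rw [hφ] at h
  rw [← h]
  rfl

/-- Spin-side norms are Fock-side norms: `⟨φ, φ⟩ = ⟨toSpinVec⁻¹ φ, toSpinVec⁻¹ φ⟩`.
[cite: EsslerEtAl2005, §12.3.4 eq. (12.196)] -/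
theorem star_dotProduct_self_eq_toSpinVec_symm {Λ : Type*} [LinearOrder Λ] [Fintype Λ]
    (φ : TensorIndex Λ 4 → ℂ) :
    star φ ⬝ᵥ φ = star (JordanWigner.toSpinVec.symm φ) ⬝ᵥ JordanWigner.toSpinVec.symm φ := by
  have hφ : JordanWigner.toSpinVec (JordanWigner.toSpinVec.symm φ) = φ :=
    LinearEquiv.apply_symm_apply _ φ
  rw [← JordanWigner.star_toSpinVec_dotProduct, hφ]

/-- **TURNKEY, length-major, ONE object, SPIN SIDE.** The sentence of
`m3Upper_tp0_le_m18o25_of_gcDefectFamily_lengthMajor` written for spin-side vectors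
`φ_l : TensorIndex (Fin (k*b) ×ₗ Fin a) 4 → ℂ` (site charge `0 ↦ 0, 1 ↦ 1, 2 ↦ 1, 3 ↦ 2`; Jordan–Wigner strings w.r.t.
the Lex order, columns of `a` sites contiguous) and the operators `toSpin (hubbardOpenBoxTT' (k*b) a 1 0 8)`,
`toSpin totalNumber`: `S = Σ Re⟨φ_l, φ_l⟩ > 0`, `Σ Re⟨φ_l, toSpin(H) φ_l⟩ - (8/5) Σ Re⟨φ_l, toSpin(N̂) φ_l⟩ ≤ (kE + (k-1)Δ)·S`,
`|Σ Re⟨φ_l, toSpin(N̂) φ_l⟩ - (7/8)·abk·S| ≤ q·S` for every `k ≥ 1`, with `(E + Δ)/(ab) ≤ -53/25` ⇒ the rung leaf. This is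
the output shape of a column-MPS / strip Bellman certificate consumer (the 2-D analogue of
`Upper.UMPSCellEnergyBound`), which therefore needs no Jordan–Wigner work at the interface.
[cite: EsslerEtAl2005, §12.3.4 eq. (12.196)] -/
theorem m3Upper_tp0_le_m18o25_of_spin_gcDefectFamily_lengthMajor (a b : ℕ) (E Δ q : ℚ) (ha : 1 ≤ a) (hb : 1 ≤ b)
    (hE : (E + Δ) / ((a : ℚ) * (b : ℚ)) ≤ -53 / 25)
    (h : ∀ k : ℕ, 1 ≤ k → ∃ m : ℕ, ∃ φ : Fin m → (TensorIndex (Fin (k * b) ×ₗ Fin a) 4 → ℂ),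
        0 < ∑ l, (star (φ l) ⬝ᵥ φ l).re ∧
        ∑ l, (star (φ l) ⬝ᵥ (JordanWigner.toSpin (hubbardOpenBoxTT' (k * b) a 1 0 8) *ᵥ φ l)).re
            - (8 / 5 : ℝ) * ∑ l, (star (φ l) ⬝ᵥ (JordanWigner.toSpin totalNumber *ᵥ φ l)).re
          ≤ (((k : ℚ) * E + ((k : ℚ) - 1) * Δ : ℚ) : ℝ) * ∑ l, (star (φ l) ⬝ᵥ φ l).re ∧
        (((7 / 8 : ℚ) * ((a : ℚ) * (b : ℚ)) * (k : ℚ) - q : ℚ) : ℝ) * ∑ l, (star (φ l) ⬝ᵥ φ l).re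
          ≤ ∑ l, (star (φ l) ⬝ᵥ (JordanWigner.toSpin totalNumber *ᵥ φ l)).re ∧
        ∑ l, (star (φ l) ⬝ᵥ (JordanWigner.toSpin totalNumber *ᵥ φ l)).re
          ≤ (((7 / 8 : ℚ) * ((a : ℚ) * (b : ℚ)) * (k : ℚ) + q : ℚ) : ℝ) * ∑ l, (star (φ l) ⬝ᵥ φ l).re) :
    Summit.Ventures.CertifiedManyBodySolver.MbsolverRungLeaves.M3Upper_tp0_le_m18o25 := by
  refine m3Upper_tp0_le_m18o25_of_gcDefectFamily_lengthMajor a b E Δ q ha hb hE fun k hk => ?_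
  obtain ⟨m, φ, hS, hH, hNlo, hNhi⟩ := h k hk
  refine ⟨m, fun l => JordanWigner.toSpinVec.symm (φ l), ?_, ?_, ?_, ?_⟩
  · simpa only [← star_dotProduct_self_eq_toSpinVec_symm] using hS
  · simpa only [← star_dotProduct_self_eq_toSpinVec_symm, ← star_dotProduct_toSpin_mulVec_eq] using hH
  · simpa only [← star_dotProduct_self_eq_toSpinVec_symm, ← star_dotProduct_toSpin_mulVec_eq] using hNlo
  · simpa only [← star_dotProduct_self_eq_toSpinVec_symm, ← star_dotProduct_toSpin_mulVec_eq] using hNhi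

/-- **TURNKEY, width-major, ONE object, SPIN SIDE**: the sentence of `m3Upper_tp0_le_m18o25_of_gcDefectFamily` for
spin-side vectors `φ_l : TensorIndex (Fin a ×ₗ Fin (k*b)) 4 → ℂ` and `toSpin (hubbardOpenBoxTT' a (k*b) 1 0 8)`,
`toSpin totalNumber` (rows contiguous in the Jordan–Wigner order) ⇒ the rung leaf.
[cite: EsslerEtAl2005, §12.3.4 eq. (12.196)] -/
theorem m3Upper_tp0_le_m18o25_of_spin_gcDefectFamily (a b : ℕ) (E Δ q : ℚ) (ha : 1 ≤ a) (hb : 1 ≤ b)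
    (hE : (E + Δ) / ((a : ℚ) * (b : ℚ)) ≤ -53 / 25)
    (h : ∀ k : ℕ, 1 ≤ k → ∃ m : ℕ, ∃ φ : Fin m → (TensorIndex (Fin a ×ₗ Fin (k * b)) 4 → ℂ),
        0 < ∑ l, (star (φ l) ⬝ᵥ φ l).re ∧
        ∑ l, (star (φ l) ⬝ᵥ (JordanWigner.toSpin (hubbardOpenBoxTT' a (k * b) 1 0 8) *ᵥ φ l)).re
            - (8 / 5 : ℝ) * ∑ l, (star (φ l) ⬝ᵥ (JordanWigner.toSpin totalNumber *ᵥ φ l)).re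
          ≤ (((k : ℚ) * E + ((k : ℚ) - 1) * Δ : ℚ) : ℝ) * ∑ l, (star (φ l) ⬝ᵥ φ l).re ∧
        (((7 / 8 : ℚ) * ((a : ℚ) * (b : ℚ)) * (k : ℚ) - q : ℚ) : ℝ) * ∑ l, (star (φ l) ⬝ᵥ φ l).re
          ≤ ∑ l, (star (φ l) ⬝ᵥ (JordanWigner.toSpin totalNumber *ᵥ φ l)).re ∧
        ∑ l, (star (φ l) ⬝ᵥ (JordanWigner.toSpin totalNumber *ᵥ φ l)).re
          ≤ (((7 / 8 : ℚ) * ((a : ℚ) * (b : ℚ)) * (k : ℚ) + q : ℚ) : ℝ) * ∑ l, (star (φ l) ⬝ᵥ φ l).re) :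
    Summit.Ventures.CertifiedManyBodySolver.MbsolverRungLeaves.M3Upper_tp0_le_m18o25 := by
  refine m3Upper_tp0_le_m18o25_of_gcDefectFamily a b E Δ q ha hb hE fun k hk => ?_
  obtain ⟨m, φ, hS, hH, hNlo, hNhi⟩ := h k hk
  refine ⟨m, fun l => JordanWigner.toSpinVec.symm (φ l), ?_, ?_, ?_, ?_⟩
  · simpa only [← star_dotProduct_self_eq_toSpinVec_symm] using hS
  · simpa only [← star_dotProduct_self_eq_toSpinVec_symm, ← star_dotProduct_toSpin_mulVec_eq] using hH
  · simpa only [← star_dotProduct_self_eq_toSpinVec_symm, ← star_dotProduct_toSpin_mulVec_eq] using hNlo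
  · simpa only [← star_dotProduct_self_eq_toSpinVec_symm, ← star_dotProduct_toSpin_mulVec_eq] using hNhi

end Summit.Ventures.CertifiedManyBodySolver.Theorems

end
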